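import Mathlib
import Summits.AtomisticToContinuum.FouriersLaw.Theorems.EmbeddedDrudeMourreMourreDissolutionVelocityShape
import Summits.AtomisticToContinuum.FouriersLaw.Theorems.EmbeddedDrudeMourreMourreDissolutionBracketModulus
import Summits.AtomisticToContinuum.FouriersLaw.Theorems.EmbeddedDrudeMourreMourreDissolutionFormFiniteSmooth
import HarnessLib

/-!
# Monotone-fibre sublevel bounds — helper file for `stub_slabNonconcentration` (stub NC)
of line `swap-odd-threshold-rigidity` (crux `EmbeddedDrudeMourre.MourreDissolution`, item
stmt-AtomisticToContinuum-12594; helper file, `--supports`)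

Generic tools: an `m`-expanding map has sublevel sets `S ∩ g⁻¹(E−r, E+r)` of Lebesgue measure `≤ 2r/m`
(`Real.volume_le_diam`), expansion from one-sided derivative floors (`Convex.mul_sub_le_image_sub_of_le_deriv`),
and the weighted fibre bound `∫_S 1{g ∈ (E−r,E+r)}·w ≤ B·2r/m`. Model tools for the pair resonance function
`Ω(k₁,k₂,k₃) = ω₁ + ω₂ − ω₃ − ω(k₁+k₂−k₃)`: its fibre derivatives in `k₂`, in `k₁` and along the diagonal
`(1,1,1)`, the periodic reduction of `k₃ − k₁`, and the weight bound
`W = Φ²(∏ω)⁻²[f]² ≤ C·sin²((k₃−k₁)/2)·sin²((k₂−k₃)/2)` from the landed bracket modulus (BM).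
No cited facts.
-/

noncomputable section

namespace Summit.AtomisticToContinuum.FouriersLaw.Theorems.MourreDissolution

open Real Set MeasureTheory Filter Topology
open scoped ENNReal
open Literature.MathematicalPhysics.KineticTheory.PhononBoltzmann

/-! ### Sublevel sets of expanding maps are short -/

/-- If `m·|t − s| ≤ |g t − g s|` for `s, t ∈ S` (`m > 0`), then `S ∩ g⁻¹(E−r, E+r)` has Lebesgue measure
`≤ 2r/m`: any two of its points are `≤ 2r/m` apart. [folklore] -/
theorem slabFibre_volume_sublevel_le {g : ℝ → ℝ} {S : Set ℝ} {m : ℝ} (hm : 0 < m)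
    (hexp : ∀ s ∈ S, ∀ t ∈ S, m * |t - s| ≤ |g t - g s|) (E r : ℝ) :
    volume (S ∩ g ⁻¹' Ioo (E - r) (E + r)) ≤ ENNReal.ofReal (2 * r / m) := by
  refine (Real.volume_le_diam _).trans (Metric.ediam_le fun s hs t ht => ?_)
  rw [edist_dist, Real.dist_eq]
  apply ENNReal.ofReal_le_ofReal
  have h1 := hexp s hs.1 t ht.1
  have hgs : g s ∈ Ioo (E - r) (E + r) := hs.2
  have hgt : g t ∈ Ioo (E - r) (E + r) := ht.2
  have h2 : |g t - g s| < 2 * r := by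
    rw [abs_sub_lt_iff]; constructor <;> linarith [hgs.1, hgs.2, hgt.1, hgt.2]
  rw [abs_sub_comm s t, le_div_iff₀ hm]
  nlinarith

/-- Expansion from a derivative floor, increasing case: `m ≤ g′` on a convex set. [folklore] -/
theorem slabFibre_expand_of_deriv_ge {g g' : ℝ → ℝ} {S : Set ℝ} (hS : Convex ℝ S) {m : ℝ}
    (hg : ∀ x ∈ S, HasDerivAt g (g' x) x) (hfloor : ∀ x ∈ S, m ≤ g' x) :
    ∀ s ∈ S, ∀ t ∈ S, m * |t - s| ≤ |g t - g s| := by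
  have hc : ContinuousOn g S := fun x hx => (hg x hx).continuousAt.continuousWithinAt
  have hd : DifferentiableOn ℝ g (interior S) := fun x hx =>
    (hg x (interior_subset hx)).differentiableAt.differentiableWithinAt
  have hf' : ∀ x ∈ interior S, m ≤ deriv g x := fun x hx => by
    rw [(hg x (interior_subset hx)).deriv]; exact hfloor x (interior_subset hx)
  have key := hS.mul_sub_le_image_sub_of_le_deriv hc hd hf'
  intro s hs t ht
  rcases le_total s t with hst | hts
  · rw [abs_of_nonneg (sub_nonneg.2 hst)]
    exact (key s hs t ht hst).trans (le_abs_self _)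
  · rw [abs_of_nonpos (sub_nonpos.2 hts), abs_sub_comm]
    have := key t ht s hs hts
    calc m * -(t - s) = m * (s - t) := by ring
      _ ≤ g s - g t := this
      _ ≤ |g s - g t| := le_abs_self _

/-- Expansion from a derivative floor, decreasing case: `g′ ≤ −m` on a convex set. [folklore] -/
theorem slabFibre_expand_of_deriv_le {g g' : ℝ → ℝ} {S : Set ℝ} (hS : Convex ℝ S) {m : ℝ}
    (hg : ∀ x ∈ S, HasDerivAt g (g' x) x) (hfloor : ∀ x ∈ S, g' x ≤ -m) :
    ∀ s ∈ S, ∀ t ∈ S, m * |t - s| ≤ |g t - g s| := by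
  have h := slabFibre_expand_of_deriv_ge (g := fun x => -g x) (g' := fun x => -g' x) hS
    (fun x hx => (hg x hx).neg) (fun x hx => by linarith [hfloor x hx])
  intro s hs t ht
  have := h s hs t ht
  rwa [show -g t - -g s = -(g t - g s) by ring, abs_neg] at this

/-- **Weighted fibre bound.** If `g` is `m`-expanding on the measurable set `S` and the weight is
`≤ B` on `S`, then `∫_S 1{g ∈ (E−r, E+r)}·w ≤ B·(2r/m)`. [folklore] -/
theorem slabFibre_weighted_le {g : ℝ → ℝ} {S : Set ℝ} (hSm : MeasurableSet S) {m : ℝ} (hm : 0 < m)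
    (hexp : ∀ s ∈ S, ∀ t ∈ S, m * |t - s| ≤ |g t - g s|) {w : ℝ → ℝ≥0∞} {B : ℝ≥0∞}
    (hw : ∀ x ∈ S, w x ≤ B) (E r : ℝ) :
    ∫⁻ x in S, (Ioo (E - r) (E + r)).indicator 1 (g x) * w x ≤ B * ENNReal.ofReal (2 * r / m) := by
  have hpt : ∀ x ∈ S, (Ioo (E - r) (E + r)).indicator 1 (g x) * w x ≤
      (g ⁻¹' Ioo (E - r) (E + r)).indicator (fun _ => B) x := by
    intro x hx
    by_cases h : g x ∈ Ioo (E - r) (E + r)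
    · rw [indicator_of_mem h, indicator_of_mem (show x ∈ g ⁻¹' Ioo (E - r) (E + r) from h),
        Pi.one_apply, one_mul]
      exact hw x hx
    · rw [indicator_of_notMem h, zero_mul]
      exact bot_le
  calc ∫⁻ x in S, (Ioo (E - r) (E + r)).indicator 1 (g x) * w x
      ≤ ∫⁻ x in S, (g ⁻¹' Ioo (E - r) (E + r)).indicator (fun _ => B) x :=
        setLIntegral_mono' hSm hpt
    _ ≤ B * (volume.restrict S) (g ⁻¹' Ioo (E - r) (E + r)) := lintegral_indicator_const_le _ _
    _ = B * volume (g ⁻¹' Ioo (E - r) (E + r) ∩ S) := by rw [Measure.restrict_apply' hSm]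
    _ ≤ B * ENNReal.ofReal (2 * r / m) := by
        rw [inter_comm]
        gcongr
        exact slabFibre_volume_sublevel_le hm hexp E r

/-! ### Fibre derivatives of the resonance function -/

/-- `∂Ω/∂k₂ = v(k₂) − v(k₁+k₂−k₃)`. [folklore] -/
theorem slabFibre_hasDerivAt_k2 {ω₂ : ℝ} (hω : 0 < ω₂) (k₁ k₂ k₃ : ℝ) :
    HasDerivAt (fun t => resonanceFn ω₂ k₁ t k₃)
      (groupVelocity ω₂ k₂ - groupVelocity ω₂ (k₁ + k₂ - k₃)) k₂ := by
  have h1 := hasDerivAt_dispersion hω k₂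
  have h2 : HasDerivAt (fun t => dispersion ω₂ (k₁ + t - k₃)) (groupVelocity ω₂ (k₁ + k₂ - k₃)) k₂ := by
    have hl : HasDerivAt (fun t : ℝ => k₁ + t - k₃) 1 k₂ := by
      simpa using ((hasDerivAt_id k₂).const_add k₁).sub_const k₃
    have := (hasDerivAt_dispersion hω (k₁ + k₂ - k₃)).comp k₂ hl
    simpa [Function.comp_def] using this
  have h := ((h1.const_add (dispersion ω₂ k₁)).sub_const (dispersion ω₂ k₃)).sub h2
  have hfun : (fun t => resonanceFn ω₂ k₁ t k₃) =
      fun t => dispersion ω₂ k₁ + dispersion ω₂ t - dispersion ω₂ k₃ - dispersion ω₂ (k₁ + t - k₃) := by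
    funext t; simp only [resonanceFn]
  rw [hfun]
  exact h

/-- `∂Ω/∂k₁ = v(k₁) − v(k₁+k₂−k₃)`. [folklore] -/
theorem slabFibre_hasDerivAt_k1 {ω₂ : ℝ} (hω : 0 < ω₂) (k₁ k₂ k₃ : ℝ) :
    HasDerivAt (fun t => resonanceFn ω₂ t k₂ k₃)
      (groupVelocity ω₂ k₁ - groupVelocity ω₂ (k₁ + k₂ - k₃)) k₁ := by
  have h1 := hasDerivAt_dispersion hω k₁
  have h2 : HasDerivAt (fun t => dispersion ω₂ (t + k₂ - k₃)) (groupVelocity ω₂ (k₁ + k₂ - k₃)) k₁ := by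
    have hl : HasDerivAt (fun t : ℝ => t + k₂ - k₃) 1 k₁ := by
      simpa using ((hasDerivAt_id k₁).add_const k₂).sub_const k₃
    have := (hasDerivAt_dispersion hω (k₁ + k₂ - k₃)).comp k₁ hl
    simpa [Function.comp_def] using this
  have h := ((h1.add_const (dispersion ω₂ k₂)).sub_const (dispersion ω₂ k₃)).sub h2
  have hfun : (fun t => resonanceFn ω₂ t k₂ k₃) =
      fun t => dispersion ω₂ t + dispersion ω₂ k₂ - dispersion ω₂ k₃ - dispersion ω₂ (t + k₂ - k₃) := by
    funext t; simp only [resonanceFn]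
  rw [hfun]
  exact h

/-- Along the diagonal `(k₁,k₂,k₃) = (z − x, z + y, z)`:
`∂Ω/∂z = v(z−x) + v(z+y) − v(z) − v(z−x+y)` (a second difference of `v`). [folklore] -/
theorem slabFibre_hasDerivAt_diag {ω₂ : ℝ} (hω : 0 < ω₂) (x y z : ℝ) :
    HasDerivAt (fun t => resonanceFn ω₂ (t - x) (t + y) t)
      (groupVelocity ω₂ (z - x) + groupVelocity ω₂ (z + y) - groupVelocity ω₂ z -
        groupVelocity ω₂ (z - x + y)) z := by
  have hA : HasDerivAt (fun t => dispersion ω₂ (t - x)) (groupVelocity ω₂ (z - x)) z := by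
    simpa [Function.comp_def] using (hasDerivAt_dispersion hω (z - x)).comp z ((hasDerivAt_id z).sub_const x)
  have hB : HasDerivAt (fun t => dispersion ω₂ (t + y)) (groupVelocity ω₂ (z + y)) z := by
    simpa [Function.comp_def] using (hasDerivAt_dispersion hω (z + y)).comp z ((hasDerivAt_id z).add_const y)
  have hC := hasDerivAt_dispersion hω z
  have hD : HasDerivAt (fun t => dispersion ω₂ (t - x + y)) (groupVelocity ω₂ (z - x + y)) z := by
    simpa [Function.comp_def] using
      (hasDerivAt_dispersion hω (z - x + y)).comp z (((hasDerivAt_id z).sub_const x).add_const y)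
  have h := ((hA.add hB).sub hC).sub hD
  have hfun : (fun t => resonanceFn ω₂ (t - x) (t + y) t) = fun t =>
      dispersion ω₂ (t - x) + dispersion ω₂ (t + y) - dispersion ω₂ t - dispersion ω₂ (t - x + y) := by
    funext t
    simp only [resonanceFn]
    rw [show t - x + (t + y) - t = t - x + y by ring]
  rw [hfun]
  exact h

/-! ### Periodic reduction of `k₃ − k₁` -/

/-- Every real `u` is `x + n·2π` with `|x| ≤ π`, `|x| ≤ π|sin(u/2)|` and `2|sin(u/2)| ≤ |x|`. [folklore] -/
theorem slabFibre_reduce (u : ℝ) :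
    ∃ n : ℤ, ∃ x : ℝ, u = x + n * (2 * π) ∧ |x| ≤ π ∧ |x| ≤ π * |sin (u / 2)| ∧
      2 * |sin (u / 2)| ≤ |x| := by
  obtain ⟨n, hn⟩ := bracketModulus_exists_reduce u
  refine ⟨n, u - n * (2 * π), by ring, hn, ?_, ?_⟩
  · rw [← bracketModulus_abs_sin_half_reduce u n]
    exact bracketModulus_abs_le_pi_mul_abs_sin_half hn
  · rw [← bracketModulus_abs_sin_half_reduce u n]
    have := Real.abs_sin_le_abs (x := (u - n * (2 * π)) / 2)
    rw [abs_div, abs_two] at this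
    linarith

/-- If moreover `|u| < 2π` (e.g. `u = k₃ − k₁` with both momenta in the cell) then `|n| ≤ 1`. [folklore] -/
theorem slabFibre_reduce_int_le {u x : ℝ} {n : ℤ} (hu : |u| < 2 * π) (hx : |x| ≤ π)
    (h : u = x + n * (2 * π)) : n = -1 ∨ n = 0 ∨ n = 1 := by
  have hn : |(n : ℝ)| * (2 * π) < 3 * π + π := by
    have : |(n : ℝ) * (2 * π)| ≤ |u| + |x| := by
      rw [show (n : ℝ) * (2 * π) = u - x by rw [h]; ring]
      exact abs_sub u x
    rw [abs_mul, abs_of_pos (by positivity : (0 : ℝ) < 2 * π)] at this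
    linarith [pi_pos]
  have hn2 : |(n : ℝ)| < 2 := by nlinarith [pi_pos, abs_nonneg (n : ℝ)]
  have : |n| < 2 := by exact_mod_cast hn2
  rcases abs_lt.1 this with ⟨h1, h2⟩
  omega

/-! ### The weight bound -/

/-- **Weight bound.** With `K` the bracket modulus of `f` (`|[f]| ≤ K|sin((k₃−k₁)/2) sin((k₂−k₃)/2)|`),
`W = Φ²(∏ω)⁻²[f]² ≤ ((|a|+16|b|)²K²/ω₂⁴)·sin²((k₃−k₁)/2)·sin²((k₂−k₃)/2)`. [folklore] -/
theorem slabFibre_weight_le {ω₂ : ℝ} (hω : 0 < ω₂) (a b : ℝ) {f : ℝ → ℝ} {K : ℝ} (hK : 0 ≤ K)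
    (hf : ∀ k₁ k₂ k₃ : ℝ, |f k₁ + f k₂ - f k₃ - f (k₁ + k₂ - k₃)| ≤
      K * |Real.sin ((k₃ - k₁) / 2) * Real.sin ((k₂ - k₃) / 2)|) (k₁ k₂ k₃ : ℝ) :
    vertex a b k₁ k₂ k₃ ^ 2 /
          (dispersion ω₂ k₁ * dispersion ω₂ k₂ * dispersion ω₂ k₃ * dispersion ω₂ (k₁ + k₂ - k₃)) ^ 2 *
        (f k₁ + f k₂ - f k₃ - f (k₁ + k₂ - k₃)) ^ 2 ≤
      (|a| + 16 * |b|) ^ 2 * K ^ 2 / ω₂ ^ 4 *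
        (Real.sin ((k₃ - k₁) / 2) ^ 2 * Real.sin ((k₂ - k₃) / 2) ^ 2) := by
  have hV := formFiniteSmooth_vertex_sq_le a b k₁ k₂ k₃
  have hP := formFiniteSmooth_pow_four_le_prod_sq hω k₁ k₂ k₃
  have hω4 : 0 < ω₂ ^ 4 := by positivity
  have hB : (f k₁ + f k₂ - f k₃ - f (k₁ + k₂ - k₃)) ^ 2 ≤
      K ^ 2 * (Real.sin ((k₃ - k₁) / 2) ^ 2 * Real.sin ((k₂ - k₃) / 2) ^ 2) := by
    have h := hf k₁ k₂ k₃
    have h0 : 0 ≤ K * |Real.sin ((k₃ - k₁) / 2) * Real.sin ((k₂ - k₃) / 2)| := by positivity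
    calc (f k₁ + f k₂ - f k₃ - f (k₁ + k₂ - k₃)) ^ 2
        = |f k₁ + f k₂ - f k₃ - f (k₁ + k₂ - k₃)| ^ 2 := (sq_abs _).symm
      _ ≤ (K * |Real.sin ((k₃ - k₁) / 2) * Real.sin ((k₂ - k₃) / 2)|) ^ 2 :=
          pow_le_pow_left₀ (abs_nonneg _) h 2
      _ = K ^ 2 * (Real.sin ((k₃ - k₁) / 2) ^ 2 * Real.sin ((k₂ - k₃) / 2) ^ 2) := by
          rw [mul_pow, sq_abs]; ring
  have h1 : vertex a b k₁ k₂ k₃ ^ 2 /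
      (dispersion ω₂ k₁ * dispersion ω₂ k₂ * dispersion ω₂ k₃ * dispersion ω₂ (k₁ + k₂ - k₃)) ^ 2 ≤
      (|a| + 16 * |b|) ^ 2 / ω₂ ^ 4 :=
    div_le_div₀ (by positivity) hV hω4 hP
  calc _ ≤ (|a| + 16 * |b|) ^ 2 / ω₂ ^ 4 *
        (K ^ 2 * (Real.sin ((k₃ - k₁) / 2) ^ 2 * Real.sin ((k₂ - k₃) / 2) ^ 2)) :=
        mul_le_mul h1 hB (sq_nonneg _) (by positivity)
    _ = _ := by ring

/-- The resonance function and the weight are symmetric under `k₁ ↔ k₂`. [folklore] -/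
theorem slabFibre_resonanceFn_swap12 (ω₂ k₁ k₂ k₃ : ℝ) :
    resonanceFn ω₂ k₂ k₁ k₃ = resonanceFn ω₂ k₁ k₂ k₃ := by
  unfold resonanceFn
  rw [show k₂ + k₁ - k₃ = k₁ + k₂ - k₃ by ring]
  ring

/-- The vertex is symmetric under `k₁ ↔ k₂`. [folklore] -/
theorem slabFibre_vertex_swap12 (a b k₁ k₂ k₃ : ℝ) :
    vertex a b k₂ k₁ k₃ = vertex a b k₁ k₂ k₃ := by
  unfold vertex
  rw [show k₂ + k₁ - k₃ = k₁ + k₂ - k₃ by ring]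
  ring

end Summit.AtomisticToContinuum.FouriersLaw.Theorems.MourreDissolution
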